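import Literature.NumberTheory.GaloisRepresentations.GSp4BigImage
import Literature.NumberTheory.GaloisRepresentations.ModPGaloisRep
import HarnessLib

/-!
# `G_{K(ζ_p)}` is the kernel of the mod-`p` cyclotomic character; the image of `G_{K(ζ_p)}` under a
# `GSp₄`-valued `ρ̄` of multiplier `ε̄⁻¹` is cut out by the multiplier

Topic `Literature/NumberTheory/GaloisRepresentations`.  Three PROVED lemmas (no definition, no named
fact) linking two existing pieces of vocabulary: the subgroup `galCyclotomicPow K p N = G_{K(ζ_{p^N})}`
of `GSp4BigImage.lean` (BCGP 2021 Def. 7.5.6) and the mod-`p` cyclotomic character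
`modPCyclotomicCharacterZMod K p : Γ_K →* (ℤ/p)ˣ` of `ModPGaloisRep.lean`.

* `mem_galCyclotomicPow_one_iff`: `σ ∈ G_{K(ζ_p)} ⟺ ε̄_p(σ) = 1` (`p` prime, `p ≠ char K`).
* `FramedGaloisRep.mem_imageOn_galCyclotomicPow_one_of_cyclotomic_eq_one`,
  `FramedGaloisRep.not_mem_imageOn_galCyclotomicPow_one_of_cyclotomic_ne_one`: for `ρ̄ : Γ_K →
  GL₄(k)` with `ρ̄(σ)ᵀ J ρ̄(σ) = ε̄(σ)⁻¹ J` (`J ≠ 0`), `ρ̄(σ)` lies in `ρ̄(G_{K(ζ_p)})` when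
  `ε̄(σ) = 1` and does NOT when `ε̄(σ) ≠ 1` — i.e. `ρ̄(G_{K(ζ_p)}) = ρ̄(G_K) ∩ Sp(J)`, the reading of
  "`Γ = Γ′ ∩ Sp₄(𝔽₃) = ρ̄(G_{ℚ(ζ₃)})`" in BCGP 2025 Lemma 6.4.3 / Table 6.4.4 used by the named
  fact `bcgp2025_modThreeListedImage_modular_abelianSurface` (its clauses (3), (4): regular
  semisimple elements in `ρ̄(G_{ℚ(ζ₃)})` and in its complement are then witnessed by Frobenius
  elements at `q ≡ 1`, resp. `q ≡ 2 (mod 3)` with separable characteristic polynomial).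

## References
* [Serre1987] J.-P. Serre, Duke Math. J. 54 (1987), §1.4 (the mod-`p` cyclotomic character
  `χ : G_ℚ → 𝔽_p^*`, `σ ζ = ζ^{χ(σ)}`).
* [BoxerEtAl2021] BCGP, Publ. Math. IHÉS 134 (2021), §7.5 Def. 7.5.6 (`G_{F(ζ_{p^N})}`).
* [BoxerCalegariGeePilloni2025] BCGP, arXiv:2502.20645, Lemma 6.4.3 / Table 6.4.4
  (`Γ = Γ′ ∩ Sp₄(𝔽₃)`, `ρ̄(G_{ℚ(ζ₃)})`).
-/

namespace Literature.NumberTheory.GaloisRepresentations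

open scoped MatrixGroups
open Matrix Field

universe u v

section Kernel

variable (K : Type u) [Field K] (p : ℕ) [Fact p.Prime] [NeZero (p : K)]

/-- **`G_{K(ζ_p)} = ker ε̄_p`**: an element of `Γ_K` fixes every `p`-th root of unity of `K̄` iff
its mod-`p` cyclotomic character is trivial (`σ ζ = ζ^{ε̄(σ)}`, Mathlib
`modularCyclotomicCharacter.spec` / `.unique`). [cite: Serre1987, §1.4 (χ : G_ℚ → 𝔽_p^*, σζ = ζ^{χ(σ)})] -/
theorem mem_galCyclotomicPow_one_iff (σ : absoluteGaloisGroup K) :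
    σ ∈ galCyclotomicPow K p 1 ↔ modPCyclotomicCharacterZMod K p σ = 1 := by
  rw [mem_galCyclotomicPow_iff]
  constructor
  · intro hσ
    ext
    refine (modularCyclotomicCharacter.unique (AlgebraicClosure K)
      (HasEnoughRootsOfUnity.natCard_rootsOfUnity (AlgebraicClosure K) p) _ fun t ht => ?_).symm
    rw [Units.val_one, ZMod.val_one, pow_one]
    have ht' : ((t : (AlgebraicClosure K)ˣ) : AlgebraicClosure K) ^ p ^ 1 = 1 := by
      rw [pow_one, ← Units.val_pow_eq_pow_val, (mem_rootsOfUnity p t).mp ht, Units.val_one]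
    exact hσ (t : AlgebraicClosure K) ht'
  · intro h ζ hζ
    rw [pow_one] at hζ
    rw [modPCyclotomicCharacterZMod_spec K p σ ζ hζ, h, Units.val_one, ZMod.val_one, pow_one]

end Kernel

section Image

variable {K : Type u} [Field K] {p : ℕ} [Fact p.Prime] [NeZero (p : K)]
  {k : Type v} [Field k] [TopologicalSpace k] {n : ℕ}

/-- If `ε̄_p(σ) = 1` then `ρ̄(σ) ∈ ρ̄(G_{K(ζ_p)})` (any framed `ρ̄`). [cite: BoxerCalegariGeePilloni2025, Lemma 6.4.3 / Table 6.4.4 (Γ = Γ′ ∩ Sp₄(𝔽₃) = ρ̄(G_{ℚ(ζ₃)}))] -/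
theorem FramedGaloisRep.mem_imageOn_galCyclotomicPow_one_of_cyclotomic_eq_one
    (ρ : FramedGaloisRep K k n) {σ : absoluteGaloisGroup K}
    (hσ : modPCyclotomicCharacterZMod K p σ = 1) :
    ρ σ ∈ ρ.imageOn (galCyclotomicPow K p 1) :=
  (ρ.mem_imageOn_iff _ _).2 ⟨σ, (mem_galCyclotomicPow_one_iff K p σ).2 hσ, rfl⟩

/-- **The multiplier separates `ρ̄(G_{K(ζ_p)})` from its complement**: if `ρ̄(τ)ᵀ J ρ̄(τ) =
f(ε̄(τ)) J` for all `τ` with `f` injective on `(ℤ/p)ˣ` (e.g. `f = (·)⁻¹`, the multiplier `ε̄⁻¹` of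
BCGP) and `J ≠ 0`, then for `ε̄(σ) ≠ 1` the element `ρ̄(σ)` is NOT in `ρ̄(G_{K(ζ_p)})` — two elements
with the same matrix have the same multiplier. [cite: BoxerCalegariGeePilloni2025, Lemma 6.4.3 (4) / Table 6.4.4 (ρ̄(G_ℚ) ∖ ρ̄(G_{ℚ(ζ₃)}) = Γ′ ∖ Sp₄(𝔽₃))] -/
theorem FramedGaloisRep.not_mem_imageOn_galCyclotomicPow_one_of_cyclotomic_ne_one
    (ρ : FramedGaloisRep K k n) {J : Matrix (Fin n) (Fin n) k} (hJ : J ≠ 0)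
    (f : (ZMod p)ˣ → k) (hf : Function.Injective f)
    (hρ : ∀ τ : absoluteGaloisGroup K,
      ((ρ τ : GL (Fin n) k) : Matrix (Fin n) (Fin n) k)ᵀ * J * ((ρ τ : GL (Fin n) k) : Matrix _ _ k) =
        f (modPCyclotomicCharacterZMod K p τ) • J)
    {σ : absoluteGaloisGroup K} (hσ : modPCyclotomicCharacterZMod K p σ ≠ 1) :
    ρ σ ∉ ρ.imageOn (galCyclotomicPow K p 1) := by
  intro hmem
  obtain ⟨τ, hτ, hτσ⟩ := (ρ.mem_imageOn_iff _ _).1 hmem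
  have hτ1 : modPCyclotomicCharacterZMod K p τ = 1 := (mem_galCyclotomicPow_one_iff K p τ).1 hτ
  have key : f (modPCyclotomicCharacterZMod K p τ) • J = f (modPCyclotomicCharacterZMod K p σ) • J := by
    rw [← hρ τ, ← hρ σ, hτσ]
  rw [← sub_eq_zero, ← sub_smul, smul_eq_zero, sub_eq_zero] at key
  rcases key with key | key
  · exact hσ (by rw [← hf key, hτ1])
  · exact hJ key

/-- The case used by the BCGP facts (`K = ℚ` or any `K`, multiplier `ε̄⁻¹`): with
`ρ̄(τ)ᵀ J ρ̄(τ) = ε̄(τ)⁻¹ J` for all `τ` and `J ≠ 0`, an element `σ` with `ε̄(σ) ≠ 1` has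
`ρ̄(σ) ∉ ρ̄(G_{K(ζ_p)})`. [cite: BoxerCalegariGeePilloni2025, Lemma 6.4.3 (4) / Table 6.4.4 (ρ̄(G_ℚ) ∖ ρ̄(G_{ℚ(ζ₃)}))] -/
theorem FramedGaloisRep.not_mem_imageOn_galCyclotomicPow_one_of_inv_cyclotomic
    (ρ : FramedGaloisRep K (ZMod p) n) {J : Matrix (Fin n) (Fin n) (ZMod p)} (hJ : J ≠ 0)
    (hρ : ∀ τ : absoluteGaloisGroup K,
      ((ρ τ : GL (Fin n) (ZMod p)) : Matrix (Fin n) (Fin n) (ZMod p))ᵀ * J *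
          ((ρ τ : GL (Fin n) (ZMod p)) : Matrix _ _ (ZMod p)) =
        (((modPCyclotomicCharacterZMod K p τ)⁻¹ : (ZMod p)ˣ) : ZMod p) • J)
    {σ : absoluteGaloisGroup K} (hσ : modPCyclotomicCharacterZMod K p σ ≠ 1) :
    ρ σ ∉ ρ.imageOn (galCyclotomicPow K p 1) :=
  ρ.not_mem_imageOn_galCyclotomicPow_one_of_cyclotomic_ne_one hJ
    (fun u : (ZMod p)ˣ => ((u⁻¹ : (ZMod p)ˣ) : ZMod p))
    (fun _ _ huv => inv_injective (Units.ext huv)) hρ hσ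

end Image

end Literature.NumberTheory.GaloisRepresentations
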